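import Literature.NumberTheory.PAdicHodge.NeronDeRhamDatum
import HarnessLib

/-!
# `exp*` transport along an ISOMORPHISM of representations is hypothesis-free (Kato, LNM 1553, Ch. II §1.2.4)

Topic `Literature/NumberTheory/PAdicHodge`, namespace `…GaloisRepresentations.PeriodRingData` (the namespace of
`PeriodRingData.dualExp_map` / `FilZeroLine.dualExpCoord_map`).  THEOREMS ONLY (kernel lane): no definition, no named fact,
no `sorry`, no instance, no notation.

WHAT.  The tree's functoriality of the Bloch–Kato dual exponential in the representation —
`PeriodRingData.dualExp_map` (`exp*(φ ∘ z) = (id ⊗ φ)(exp* z)`) and `FilZeroLine.dualExpCoord_map`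
(`exp*_{φω}(φ ∘ z) = exp*_ω(z)`) — is stated for a MORPHISM `φ : V → V′` under `CupLogInjective` on both sides and
`HasDualExp z` (so that `exp*` is characterised by Kato's relation on both sides).  Along a linear EQUIVALENCE
`φ : V ≃ V′` intertwining `ρ, ρ′` — the case of an isogeny of elliptic curves read on RATIONAL Tate modules — NONE of
these inputs is needed: the definitions `dualExp` (`if h : ∃! x, IsDualExpOf ψ ρ z x then h.choose else 0`) and
`dualExpCoord` are equivariant under transport of structure, JUNK BRANCH INCLUDED (`IsDualExpOf` moves forward along `φ`
and backward along `φ⁻¹`, so `∃!` ↦ `∃!` and `0 ↦ 0`).  Proved here: `dualExp_map_equiv` and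
`FilZeroLine.dualExpCoord_map_equiv`, with the two transport directions `IsDualExpOf.map_equiv` / `IsDualExpOf.of_map_equiv`.

PROVENANCE.  This is the probe `DualExpTransportEquiv_g18.lean` (sha16 b949ee3b01c1109e, 93 l., farm rc 0, axioms standard) of the
critic seat idea-crit-15 g18 (cell bsd-cm, NOTE #21 (B), 2026-08-31), answering pen bsd-cm-plan g39 D1138/D1139 («is exp*-naturality
provable from the data's fields?»); ported verbatim (helpers `private`, docstrings cited) by seat bsd-cm-k-ty1 g35 as the first input of
the (T5-nat) row of the `𝒞₇` genus road (crux `EllipticUnitValueSevenOfGZK`, stmt-BirchSwinnertonDyer-19945): the semi-local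
`DefinedExpStarBody` clauses of a realised zeta family are `(bdRPeriodRingData hL).dualExpCoord …` on ONE datum shared by `W` and its
prime-to-`p` isogenous partner `W₂`, so they transport along `V_pβ : V_pW ⥲ V_pW₂` by these two lemmas with no `p`-adic Hodge input.

HONEST LABEL: kernel facts about the tree's own definitions; nothing about elliptic curves, zeta elements or BSD is proved; no summit
statement is touched.

## References
* [Kato1993LNM1553] K. Kato, *Lectures on the approach to Iwasawa theory for Hasse–Weil L-functions via B_dR*, LNM 1553 (1993),
  Ch. II §1.2.3–1.2.4 (the dual exponential map and its functoriality), Ex. 1.3.5.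
* [BlochKato1990] S. Bloch, K. Kato, *L-functions and Tamagawa numbers of motives* (1990), Def. 3.10 and Ex. 3.11 (p. 361)
  (`exp*` natural in `V`).
* Tree: `PAdicHodge/BlochKatoDualExponential.lean` (`IsDualExpOf.map`, `dualExp_map`, `dualExpCoord`, `dualExp_eq_of_existsUnique`,
  `dualExp_eq_zero_of_not`), `PAdicHodge/NeronDeRhamDatum.lean` (`FilZeroLine.map`, `map_ω`, `dualExpCoord_map`, `dualExp_eq_coord_smul`).
-/

noncomputable section

open scoped TensorProduct

namespace Literature.NumberTheory.GaloisRepresentations.PeriodRingData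

universe u v v' w w'

variable {Γ : Type u} [Group Γ] [TopologicalSpace Γ] {P : Type v} {E : Type v'} [Field P]
  [TopologicalSpace P] [Field E] [Algebra P E]
  {M : Type w'} [AddCommGroup M] [Module P M] [TopologicalSpace M]
  {M' : Type w'} [AddCommGroup M'] [Module P M'] [TopologicalSpace M']
  {𝔅 : PeriodRingData.{u, v, v', w} Γ P E} {ψ : Γ → P} {ρ : ContinuousRep Γ P M} {ρ' : ContinuousRep Γ P M'}
  {φ : M ≃ₗ[P] M'}

omit [TopologicalSpace Γ] [TopologicalSpace P] [TopologicalSpace M] [TopologicalSpace M'] in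
/-- `(id ⊗ φ⁻¹) ∘ (id ⊗ φ) = id`. [folklore] -/
private theorem tensorMap_symm_tensorMap_apply (x : 𝔅.B ⊗[P] M) :
    𝔅.tensorMap (φ.symm : M' →ₗ[P] M) (𝔅.tensorMap (φ : M →ₗ[P] M') x) = x := by
  induction x using TensorProduct.induction_on with
  | zero => simp
  | tmul b m => simp
  | add x y hx hy => simp only [map_add, hx, hy]

omit [TopologicalSpace Γ] [TopologicalSpace P] [TopologicalSpace M] [TopologicalSpace M'] in
/-- `(id ⊗ φ) ∘ (id ⊗ φ⁻¹) = id`. [folklore] -/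
private theorem tensorMap_tensorMap_symm_apply (x : 𝔅.B ⊗[P] M') :
    𝔅.tensorMap (φ : M →ₗ[P] M') (𝔅.tensorMap (φ.symm : M' →ₗ[P] M) x) = x := by
  induction x using TensorProduct.induction_on with
  | zero => simp
  | tmul b m => simp
  | add x y hx hy => simp only [map_add, hx, hy]

/-- An intertwining isomorphism intertwines backwards. [folklore] -/
private theorem symm_intertwines_apply (hφ : ∀ σ m, φ (ρ σ m) = ρ' σ (φ m)) (σ : Γ) (m' : M') :
    φ.symm (ρ' σ m') = ρ σ (φ.symm m') :=
  φ.injective (by rw [LinearEquiv.apply_symm_apply, hφ, LinearEquiv.apply_symm_apply])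

/-- Kato's relation `IsDualExpOf` transports FORWARD along an intertwining isomorphism `φ`:
if `x` is a dual exponential of `z` then `(id ⊗ φ) x` is one of `φ ∘ z`. [cite: Kato1993LNM1553, Ch. II §1.2.4] -/
theorem IsDualExpOf.map_equiv (hφ : ∀ σ m, φ (ρ σ m) = ρ' σ (φ m)) {z : Γ → M} {x : 𝔅.B ⊗[P] M}
    (h : 𝔅.IsDualExpOf ψ ρ z x) :
    𝔅.IsDualExpOf ψ ρ' (fun σ => φ (z σ)) (𝔅.tensorMap (φ : M →ₗ[P] M') x) := by
  have := h.map (φ := (φ : M →ₗ[P] M')) (ρ' := ρ') hφ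
  simpa only [LinearEquiv.coe_coe] using this

/-- Kato's relation `IsDualExpOf` transports BACKWARD along an intertwining isomorphism `φ`:
a dual exponential `x′` of `φ ∘ z` gives the dual exponential `(id ⊗ φ⁻¹) x′` of `z`. [cite: Kato1993LNM1553, Ch. II §1.2.4] -/
theorem IsDualExpOf.of_map_equiv (hφ : ∀ σ m, φ (ρ σ m) = ρ' σ (φ m)) {z : Γ → M} {x' : 𝔅.B ⊗[P] M'}
    (h : 𝔅.IsDualExpOf ψ ρ' (fun σ => φ (z σ)) x') :
    𝔅.IsDualExpOf ψ ρ z (𝔅.tensorMap (φ.symm : M' →ₗ[P] M) x') := by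
  have := h.map (φ := (φ.symm : M' →ₗ[P] M)) (ρ' := ρ) (symm_intertwines_apply hφ)
  simpa only [LinearEquiv.coe_coe, LinearEquiv.symm_apply_apply] using this

/-- **`exp*(φ ∘ z) = (id ⊗ φ)(exp* z)` along an ISOMORPHISM of representations, with NO injectivity / existence
hypothesis** (compare `dualExp_map`): unique existence of a dual exponential, and the junk branch `0`, are both
invariant under transport of structure along `φ` / `φ⁻¹`. [cite: Kato1993LNM1553, Ch. II §1.2.4] [cite: BlochKato1990, Def. 3.10 and Ex. 3.11 (p. 361)] -/
theorem dualExp_map_equiv (hφ : ∀ σ m, φ (ρ σ m) = ρ' σ (φ m)) (z : Γ → M) :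
    𝔅.dualExp ψ ρ' (fun σ => φ (z σ)) = 𝔅.tensorMap (φ : M →ₗ[P] M') (𝔅.dualExp ψ ρ z) := by
  by_cases h : ∃! x, 𝔅.IsDualExpOf ψ ρ z x
  · have h' : ∃! x', 𝔅.IsDualExpOf ψ ρ' (fun σ => φ (z σ)) x' := by
      refine ⟨𝔅.tensorMap (φ : M →ₗ[P] M') h.choose, h.choose_spec.1.map_equiv hφ, fun x' hx' => ?_⟩
      rw [← h.unique (hx'.of_map_equiv hφ) h.choose_spec.1, tensorMap_tensorMap_symm_apply]
    rw [dualExp_eq_of_existsUnique h', dualExp_eq_of_existsUnique h]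
    exact h'.unique h'.choose_spec.1 (h.choose_spec.1.map_equiv hφ)
  · have h' : ¬ ∃! x', 𝔅.IsDualExpOf ψ ρ' (fun σ => φ (z σ)) x' := by
      intro h'
      refine h ⟨𝔅.tensorMap (φ.symm : M' →ₗ[P] M) h'.choose, h'.choose_spec.1.of_map_equiv hφ, fun x hx => ?_⟩
      rw [← h'.unique (hx.map_equiv hφ) h'.choose_spec.1, tensorMap_symm_tensorMap_apply]
    rw [dualExp_eq_zero_of_not h', dualExp_eq_zero_of_not h, map_zero]

/-- **`exp*_{φω}(φ ∘ z) = exp*_ω(z)` along an isomorphism of representations, HYPOTHESIS-FREE** (compare the tree's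
`FilZeroLine.dualExpCoord_map`, which asks `CupLogInjective` on both sides and `HasDualExp z`): the scalar dual exponential
along a generator `ω` of the line `Fil⁰ D(V)` is invariant under transporting BOTH the cocycle and the generator.  For an
isogeny `β : W → W₂` of elliptic curves read on `V_p` this is `exp*_{(V_pβ)ω}((V_pβ)_* z) = exp*_ω(z)`.
[cite: Kato1993LNM1553, Ch. II §1.2.4 and Ex. 1.3.5] [cite: BlochKato1990, Def. 3.10 and Ex. 3.11 (p. 361)] -/
theorem FilZeroLine.dualExpCoord_map_equiv (d : 𝔅.FilZeroLine ρ) (hφ : ∀ σ m, φ (ρ σ m) = ρ' σ (φ m))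
    (z : Γ → M) :
    𝔅.dualExpCoord ψ ρ' (d.map φ hφ).ω (fun σ => φ (z σ)) = 𝔅.dualExpCoord ψ ρ d.ω z :=
  dualExpCoord_eq (d.map φ hφ).ne_zero (by
    rw [FilZeroLine.map_ω, dualExp_map_equiv hφ, d.dualExp_eq_coord_smul z, map_smul])

end Literature.NumberTheory.GaloisRepresentations.PeriodRingData

end
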